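import Summits.FinalStateConjecture.FinalStateConjecture.Theorems.StarvedNecksNecksCertifyStubSeamSurgeryRide

/-!
# Route StarvedNecks — crux `NecksCertify`, line `two-cap-focusing-ledger`: seam surgery, anchoring below discs

Helper file for the registered stub `stub_seamSurgery` (N2): clause `HonestCore`(2) of the seamed
decomposition for one hole (`drain_disc`): every hole-late point of the new chart with `r < ϱ`
lies in `J⁻` of the new chart's image of every later disc `{t₂ = τ₂, r ≤ ϱ}`, `ϱ ≥ R₁` — by the
input's anchoring inside `R₁ + 1/4` (A2), the co-moving ride on the certified tube (A8,
`ride_mem_causalFuture`), and, on the squashed far leaves, the ride from the squashed point pulled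
back through the squash (whose ceiling is non-decreasing in hole time).  Registered helper sub-goal
`stub_seamSurgery_gNonneg` (anchor): a squash profile fixing the non-positive reals and of slope at
most one lies below the identity on the non-negative reals.

References: B. O'Neill, *Semi-Riemannian geometry*, Academic Press 1983, Ch. 14, p. 402.
Mathlib + the landed `…StubSeamSurgeryRide` module; no definitions, no named facts.
-/

noncomputable section

open scoped Manifold ContDiff Topology ENNReal
open Filter Set Function Topology Literature.Geometry.Lorentzian

namespace Summit.FinalStateConjecture.FinalStateConjecture.Theorems.NecksCertifyTwoCap.Seam

set_option linter.dupNamespace false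

open Summit.FinalStateConjecture.FinalStateConjecture.Theorems.SeamedChartsExhaust.WideAnchoring
  (radius_add_smul_e₀ poincareInv_add_smul)

/-- Registered helper sub-goal `stub_seamSurgery_gNonneg` of N2 (anchor of this file): a real
function with `g 0 = 0` and increments bounded by those of the identity lies below the identity on
`[0, ∞)`. [folklore] -/
theorem stub_seamSurgery_gNonneg :
    ∀ (g : ℝ → ℝ), g 0 = 0 → (∀ u v, u ≤ v → g v - g u ≤ v - u) → ∀ u, 0 ≤ u → g u ≤ u := by
  intro g h0 hl u hu
  have := hl 0 u hu
  rw [h0] at this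
  linarith

/-- **Anchoring of the new hole chart below later discs** (clause `HonestCore`(2) for the seamed
decomposition, one hole).  For a hole-late point `x` of the re-clocked chart (`t x > T + s`) with
`r x < ϱ`, `R₁ ≤ ϱ`, and a later re-clocked slab time `τ₂` (`t x < τ₂ + s`): `Gl x` lies in `J⁻` of
the `Gl`-image of the disc `{t = τ₂ + s, r ≤ ϱ}`.  Inside `R₁ + 1/4` this is the input's anchoring
(A2: `Ψ' = Ψ` there); on the certified tube it is the co-moving ride (`ride_mem_causalFuture`, A8);
on the squashed far leaves the ride starts at the squashed point (ONE ATLAS) and, if it ends beyond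
the shell, is pulled back through the squash (`hG7`; the squash ceiling is non-decreasing in hole
time).  O'Neill 1983, Ch. 14, p. 402. [folklore] -/
theorem drain_disc {𝓢 : Spacetime.{0} 4} (Λ : lorentzGroup) (c : E4) (M a R₁ τ₁ s τf T : ℝ)
    (hR₁4 : 0 < R₁ + 4) (hs : 0 ≤ s) (hτ : τf ≤ τ₁) (hT : τ₁ + 3 ≤ T)
    (hdomR : ∀ y : E4, R₁ + 4 < (boostedKerrBackground Λ c M a).radius y → y ∈ (boostedKerrBackground Λ c M a).domain)
    (hdompos : ∀ y : E4, y ∈ (boostedKerrBackground Λ c M a).domain → 0 < (boostedKerrBackground Λ c M a).radius y)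
    (hdomeq : ∀ y y' : E4, (boostedKerrBackground Λ c M a).radius y' = (boostedKerrBackground Λ c M a).radius y → y ∈ (boostedKerrBackground Λ c M a).domain → y' ∈ (boostedKerrBackground Λ c M a).domain)
    (Rg : ℝ → ℝ) (hRgm : Monotone Rg) (hRgc : Continuous Rg) (hRg4 : ∀ t, R₁ + 4 ≤ Rg t)
    (b : ℝ → ℝ) (hbm : Monotone b) (hbRg : ∀ t, Rg t + 21 / 20 ≤ b t ∧ b t ≤ Rg t + 29 / 20)
    (σ : ℝ → ℝ → ℝ) (G : E4 → E4)
    (hσ2 : ∀ t, StrictMono (σ t)) (hσ3 : ∀ t ρ, σ t ρ < b t + 1 / 2)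
    (hσ4 : ∀ t ρ, b t ≤ ρ → b t ≤ σ t ρ) (hσ5 : ∀ t t' ρ, t ≤ t' → σ t ρ ≤ σ t' ρ)
    (hσ8 : ∀ t ρ, b t ≤ ρ → σ t ρ ≤ ρ)
    (hG1 : ∀ y, (boostedKerrBackground Λ c M a).time (G y) = (boostedKerrBackground Λ c M a).time y)
    (hG2 : ∀ y, 0 < (boostedKerrBackground Λ c M a).radius y → (boostedKerrBackground Λ c M a).radius (G y) = σ ((boostedKerrBackground Λ c M a).time y) ((boostedKerrBackground Λ c M a).radius y))
    (hG3 : ∀ y, 0 < (boostedKerrBackground Λ c M a).radius y → (boostedKerrBackground Λ c M a).radius y ≤ b ((boostedKerrBackground Λ c M a).time y) → G y = y)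
    (hG7 : ∀ z, R₁ + 4 < (boostedKerrBackground Λ c M a).radius z → (∃ ϱ, (boostedKerrBackground Λ c M a).radius z < σ ((boostedKerrBackground Λ c M a).time z) ϱ) →
      ∃ y, R₁ + 4 < (boostedKerrBackground Λ c M a).radius y ∧ (boostedKerrBackground Λ c M a).time y = (boostedKerrBackground Λ c M a).time z ∧ G y = z)
    (Ψ Ψ' Gl : (boostedKerrBackground Λ c M a).domain → 𝓢.carrier)
    (hA1a : ContMDiffOn 𝓘(ℝ, E4) (𝓡 4) ∞ Ψ'
      {x | τ₁ < (boostedKerrBackground Λ c M a).time x ∧ (boostedKerrBackground Λ c M a).radius x < Rg ((boostedKerrBackground Λ c M a).time x) + 2})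
    (hA2 : ∀ x : (boostedKerrBackground Λ c M a).domain, (boostedKerrBackground Λ c M a).radius x ≤ R₁ + 1 → Ψ' x = Ψ x)
    (hA8 : ∀ x : (boostedKerrBackground Λ c M a).domain, τ₁ ≤ (boostedKerrBackground Λ c M a).time x → R₁ ≤ (boostedKerrBackground Λ c M a).radius x →
      (boostedKerrBackground Λ c M a).radius x ≤ Rg ((boostedKerrBackground Λ c M a).time x) + 2 →
      𝓢.timeOrientation.IsFutureDirected (mfderiv 𝓘(ℝ, E4) (𝓡 4) Ψ' x ((Λ : E4 ≃L[ℝ] E4) (E4.basisVector 0))))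
    (hHc2 : ∀ ϱ τ₂ : ℝ, R₁ ≤ ϱ → τf < τ₂ →
      Ψ '' {x | τf < (boostedKerrBackground Λ c M a).time x ∧ (boostedKerrBackground Λ c M a).time x < τ₂ ∧ (boostedKerrBackground Λ c M a).radius x < ϱ} ⊆
        𝓢.metric.causalPast 𝓢.timeOrientation (Ψ '' (boostedKerrBackground Λ c M a).truncTimeSlab ϱ τ₂))
    (W₀ : TopologicalSpace.Opens E4) (Φ : W₀ → 𝓢.carrier) (P : E4 → Prop)
    (hA3 : ∀ (y : E4) (hy : y ∈ (boostedKerrBackground Λ c M a).domain), τ₁ ≤ y 0 → P y →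
      (boostedKerrBackground Λ c M a).radius y ≤ Rg ((boostedKerrBackground Λ c M a).time y) + 2 → ∃ hw : y ∈ W₀, Ψ' ⟨y, hy⟩ = Φ ⟨y, hw⟩)
    (hcollar : ∀ y : E4, y ∈ (boostedKerrBackground Λ c M a).domain → τ₁ + 1 + s < (boostedKerrBackground Λ c M a).time y →
      Rg ((boostedKerrBackground Λ c M a).time y) + 17 / 20 < (boostedKerrBackground Λ c M a).radius y → (boostedKerrBackground Λ c M a).radius y < Rg ((boostedKerrBackground Λ c M a).time y) + 2 →
      τ₁ ≤ y 0 ∧ τf < y 0 ∧ P y)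
    (hGl2 : ∀ x : (boostedKerrBackground Λ c M a).domain, τ₁ + 2 + s ≤ (boostedKerrBackground Λ c M a).time x → (boostedKerrBackground Λ c M a).radius x < b ((boostedKerrBackground Λ c M a).time x) →
      Gl x = Ψ' x)
    (hGl3 : ∀ x : (boostedKerrBackground Λ c M a).domain, τ₁ + 2 + s ≤ (boostedKerrBackground Λ c M a).time x → b ((boostedKerrBackground Λ c M a).time x) ≤ (boostedKerrBackground Λ c M a).radius x →
      ∃ hw : G x ∈ W₀, Gl x = Φ ⟨G x, hw⟩ ∧ τf < G x 0)
    (x : E4) (hx : x ∈ (boostedKerrBackground Λ c M a).domain) (τ₂ ϱ : ℝ) (htx : T + s < (boostedKerrBackground Λ c M a).time x)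
    (htx2 : (boostedKerrBackground Λ c M a).time x < τ₂ + s) (hrx : (boostedKerrBackground Λ c M a).radius x < ϱ) (hϱ : R₁ ≤ ϱ) :
    Gl ⟨x, hx⟩ ∈ 𝓢.metric.causalPast 𝓢.timeOrientation
      (Gl '' {y | (boostedKerrBackground Λ c M a).time y = τ₂ + s ∧ (boostedKerrBackground Λ c M a).radius y ≤ ϱ}) := by
  have htv : ∀ (y : E4) (σ' : ℝ), (boostedKerrBackground Λ c M a).time (y + σ' • (Λ : E4 ≃L[ℝ] E4) (E4.basisVector 0)) =
      (boostedKerrBackground Λ c M a).time y + σ' := fun y σ' ↦ by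
    show poincareInv Λ c (y + σ' • (Λ : E4 ≃L[ℝ] E4) (E4.basisVector 0)) 0 = poincareInv Λ c y 0 + σ'
    rw [poincareInv_add_smul]; simp
  have hrv : ∀ (y : E4) (σ' : ℝ), (boostedKerrBackground Λ c M a).radius (y + σ' • (Λ : E4 ≃L[ℝ] E4) (E4.basisVector 0)) =
      (boostedKerrBackground Λ c M a).radius y := fun y σ' ↦ by
    show Kerr.radius a (poincareInv Λ c (y + σ' • (Λ : E4 ≃L[ℝ] E4) (E4.basisVector 0))) =
      Kerr.radius a (poincareInv Λ c y)
    rw [poincareInv_add_smul, radius_add_smul_e₀]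
  have hlate_x : τ₁ + 2 + s ≤ (boostedKerrBackground Λ c M a).time x := by linarith
  have hb5 : ∀ t, R₁ + 5 ≤ b t := fun t ↦ by linarith [(hbRg t).1, hRg4 t]
  have hτfx : τf < (boostedKerrBackground Λ c M a).time x := by linarith
  rcases lt_or_ge ((boostedKerrBackground Λ c M a).radius x) (R₁ + 1 / 4) with hsmall | hbig
  · -- inside `R₁ + 1/4`: the input's anchoring through `Ψ' = Ψ = Gl`
    have hGlx : Gl ⟨x, hx⟩ = Ψ ⟨x, hx⟩ :=
      (hGl2 ⟨x, hx⟩ hlate_x (by show (boostedKerrBackground Λ c M a).radius x < _; linarith [hb5 ((boostedKerrBackground Λ c M a).time x)])).trans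
        (hA2 ⟨x, hx⟩ (by show (boostedKerrBackground Λ c M a).radius x ≤ _; linarith))
    have h1 := hHc2 (min ϱ (R₁ + 1 / 2)) (τ₂ + s) (le_min hϱ (by linarith)) (by linarith)
      ⟨⟨x, hx⟩, ⟨hτfx, htx2, lt_min hrx (by show (boostedKerrBackground Λ c M a).radius x < _; linarith)⟩, rfl⟩
    rw [hGlx]
    refine LorentzianMetric.causalFuture_mono ?_ h1
    rintro _ ⟨y, ⟨hyt, hyr⟩, rfl⟩
    have hyt' : (boostedKerrBackground Λ c M a).time y = τ₂ + s := hyt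
    have hyr' : (boostedKerrBackground Λ c M a).radius y ≤ min ϱ (R₁ + 1 / 2) := hyr
    refine ⟨y, ⟨hyt', hyr'.trans (min_le_left _ _)⟩, ?_⟩
    rw [hGl2 y (by rw [hyt']; linarith) (by linarith [hb5 ((boostedKerrBackground Λ c M a).time y), hyr'.trans (min_le_right _ _)]),
      hA2 y (by linarith [hyr'.trans (min_le_right _ _)])]
  · rcases lt_or_ge ((boostedKerrBackground Λ c M a).radius x) (b ((boostedKerrBackground Λ c M a).time x)) with hin | hout
    · -- on the certified tube: ride from `x`
      have hu : 0 ≤ τ₂ + s - (boostedKerrBackground Λ c M a).time x := by linarith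
      have hmem : x + (τ₂ + s - (boostedKerrBackground Λ c M a).time x) • (Λ : E4 ≃L[ℝ] E4) (E4.basisVector 0) ∈ (boostedKerrBackground Λ c M a).domain :=
        hdomeq x _ (hrv x _) hx
      have hride := ride_mem_causalFuture Λ c M a R₁ τ₁ Rg hRgm hRgc Ψ' hA1a hA8 hdomeq x hx
        (by linarith) (by linarith) (by linarith [(hbRg ((boostedKerrBackground Λ c M a).time x)).2]) _ hu hmem
      have hGlx : Gl ⟨x, hx⟩ = Ψ' ⟨x, hx⟩ := hGl2 _ hlate_x hin
      have hte : (boostedKerrBackground Λ c M a).time (x + (τ₂ + s - (boostedKerrBackground Λ c M a).time x) • (Λ : E4 ≃L[ℝ] E4) (E4.basisVector 0)) =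
          τ₂ + s := by rw [htv]; ring
      have hre := hrv x (τ₂ + s - (boostedKerrBackground Λ c M a).time x)
      have hGle : Gl ⟨_, hmem⟩ = Ψ' ⟨_, hmem⟩ := hGl2 _ (by show _ ≤ (boostedKerrBackground Λ c M a).time _; rw [hte]; linarith)
        (by show (boostedKerrBackground Λ c M a).radius _ < b ((boostedKerrBackground Λ c M a).time _); rw [hre, hte]; exact hin.trans_le (hbm (by linarith)))
      rw [hGlx]
      refine LorentzianMetric.causalFuture_mono ?_
        (LorentzianMetric.mem_causalPast_of_mem_causalFuture hride)
      rintro _ rfl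
      exact ⟨⟨_, hmem⟩, ⟨hte, by show (boostedKerrBackground Λ c M a).radius _ ≤ ϱ; rw [hre]; exact hrx.le⟩, hGle⟩
    · -- on the squashed far leaves: ride from the squashed point `z = G x`
      obtain ⟨hw, hGlx, -⟩ := hGl3 ⟨x, hx⟩ hlate_x hout
      have hr0 : 0 < (boostedKerrBackground Λ c M a).radius x := hdompos x hx
      have htz : (boostedKerrBackground Λ c M a).time (G x) = (boostedKerrBackground Λ c M a).time x := hG1 x
      have hrz : (boostedKerrBackground Λ c M a).radius (G x) = σ ((boostedKerrBackground Λ c M a).time x) ((boostedKerrBackground Λ c M a).radius x) := hG2 x hr0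
      have hrz1 : b ((boostedKerrBackground Λ c M a).time x) ≤ (boostedKerrBackground Λ c M a).radius (G x) := by rw [hrz]; exact hσ4 _ _ hout
      have hrz2 : (boostedKerrBackground Λ c M a).radius (G x) < b ((boostedKerrBackground Λ c M a).time x) + 1 / 2 := by rw [hrz]; exact hσ3 _ _
      have hrz3 : (boostedKerrBackground Λ c M a).radius (G x) ≤ (boostedKerrBackground Λ c M a).radius x := by rw [hrz]; exact hσ8 _ _ hout
      have hzdom : G x ∈ (boostedKerrBackground Λ c M a).domain := hdomR _ (by linarith [hb5 ((boostedKerrBackground Λ c M a).time x)])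
      obtain ⟨hz0, -, hPz⟩ := hcollar (G x) hzdom (by rw [htz]; linarith)
        (by rw [htz]; linarith [(hbRg ((boostedKerrBackground Λ c M a).time x)).1]) (by rw [htz]; linarith [(hbRg ((boostedKerrBackground Λ c M a).time x)).2])
      obtain ⟨hw', hΨz⟩ := hA3 (G x) hzdom hz0 hPz (by rw [htz]; linarith [(hbRg ((boostedKerrBackground Λ c M a).time x)).2])
      have hGlx' : Gl ⟨x, hx⟩ = Ψ' ⟨G x, hzdom⟩ := by rw [hGlx, hΨz]
      have hu : 0 ≤ τ₂ + s - (boostedKerrBackground Λ c M a).time x := by linarith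
      have hmem : G x + (τ₂ + s - (boostedKerrBackground Λ c M a).time x) • (Λ : E4 ≃L[ℝ] E4) (E4.basisVector 0) ∈ (boostedKerrBackground Λ c M a).domain :=
        hdomeq (G x) _ (hrv (G x) _) hzdom
      have hride := ride_mem_causalFuture Λ c M a R₁ τ₁ Rg hRgm hRgc Ψ' hA1a hA8 hdomeq (G x) hzdom
        (by rw [htz]; linarith) (by linarith [hb5 ((boostedKerrBackground Λ c M a).time x)])
        (by rw [htz]; linarith [(hbRg ((boostedKerrBackground Λ c M a).time x)).2]) _ hu hmem
      have hte : (boostedKerrBackground Λ c M a).time (G x + (τ₂ + s - (boostedKerrBackground Λ c M a).time x) • (Λ : E4 ≃L[ℝ] E4) (E4.basisVector 0)) =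
          τ₂ + s := by rw [htv, htz]; ring
      have hre := hrv (G x) (τ₂ + s - (boostedKerrBackground Λ c M a).time x)
      have hxe : (boostedKerrBackground Λ c M a).time x ≤ τ₂ + s := by linarith
      rw [hGlx']
      refine LorentzianMetric.causalFuture_mono ?_
        (LorentzianMetric.mem_causalPast_of_mem_causalFuture hride)
      rintro _ rfl
      rcases lt_or_ge ((boostedKerrBackground Λ c M a).radius (G x)) (b (τ₂ + s)) with h1 | h1
      · refine ⟨⟨_, hmem⟩, ⟨hte, by show (boostedKerrBackground Λ c M a).radius _ ≤ ϱ; rw [hre]; linarith⟩, ?_⟩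
        exact hGl2 _ (by show _ ≤ (boostedKerrBackground Λ c M a).time _; rw [hte]; linarith)
          (by show (boostedKerrBackground Λ c M a).radius _ < b ((boostedKerrBackground Λ c M a).time _); rw [hre, hte]; exact h1)
      · -- the ride ends beyond the shell at the later time: pull back through the squash
        have hedom : G x + (τ₂ + s - (boostedKerrBackground Λ c M a).time x) • (Λ : E4 ≃L[ℝ] E4) (E4.basisVector 0) ∈
            (boostedKerrBackground Λ c M a).domain := hmem
        obtain ⟨he0, -, hPe⟩ := hcollar _ hedom (by rw [hte]; linarith)
          (by rw [hre, hte]; linarith [(hbRg (τ₂ + s)).1])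
          (by rw [hre, hte]; linarith [(hbRg (τ₂ + s)).2, (hbRg ((boostedKerrBackground Λ c M a).time x)).2, hbm hxe])
        obtain ⟨hwe, hΨe⟩ := hA3 _ hedom he0 hPe
          (by rw [hre, hte]; linarith [(hbRg (τ₂ + s)).2, (hbRg ((boostedKerrBackground Λ c M a).time x)).2, hbm hxe])
        have hceil : (boostedKerrBackground Λ c M a).radius (G x) < σ (τ₂ + s) ϱ :=
          calc (boostedKerrBackground Λ c M a).radius (G x) = σ ((boostedKerrBackground Λ c M a).time x) ((boostedKerrBackground Λ c M a).radius x) := hrz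
            _ ≤ σ (τ₂ + s) ((boostedKerrBackground Λ c M a).radius x) := hσ5 _ _ _ hxe
            _ < σ (τ₂ + s) ϱ := hσ2 _ hrx
        obtain ⟨y, hyr, hyt, hGy⟩ := hG7 _ (by rw [hre]; linarith [hb5 ((boostedKerrBackground Λ c M a).time x)])
          ⟨ϱ, by rw [hre, hte]; exact hceil⟩
        rw [hte] at hyt
        have hydom : y ∈ (boostedKerrBackground Λ c M a).domain := hdomR y hyr
        have hy0 : 0 < (boostedKerrBackground Λ c M a).radius y := by linarith
        have hGy' : (boostedKerrBackground Λ c M a).radius (G y) = σ (τ₂ + s) ((boostedKerrBackground Λ c M a).radius y) := by rw [hG2 y hy0, hyt]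
        rw [hGy, hre] at hGy'
        have hry : (boostedKerrBackground Λ c M a).radius y < ϱ := by
          by_contra hcon
          push Not at hcon
          have := (hσ2 (τ₂ + s)).monotone hcon
          linarith
        have hby : b ((boostedKerrBackground Λ c M a).time y) ≤ (boostedKerrBackground Λ c M a).radius y := by
          by_contra hcon
          push Not at hcon
          have hid := hG3 y hy0 hcon.le
          rw [hid] at hGy
          have h2 : (boostedKerrBackground Λ c M a).radius y = (boostedKerrBackground Λ c M a).radius (G x) := by rw [hGy, hre]
          rw [hyt, h2] at hcon
          linarith
        obtain ⟨hw'', hGly, -⟩ := hGl3 ⟨y, hydom⟩ (by show _ ≤ (boostedKerrBackground Λ c M a).time y; rw [hyt]; linarith) hby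
        refine ⟨⟨y, hydom⟩, ⟨hyt, hry.le⟩, ?_⟩
        rw [hGly, hΨe]
        congr 1
        exact Subtype.ext hGy



end Summit.FinalStateConjecture.FinalStateConjecture.Theorems.NecksCertifyTwoCap.Seam

end
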